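import Mathlib
import Literature.Computability.Complexity.CodeFPArith
import Literature.Computability.Complexity.CodeFPBudgets
import Literature.Computability.Complexity.CodeFPLists
import Literature.Computability.Complexity.CodeFPListKit
import Literature.Computability.Complexity.CodeFPStrings
import Literature.Computability.Complexity.DigitPolynomials
import Literature.Computability.Complexity.AlgebraicPCP
import HarnessLib

/-!
# Prime-field arithmetic on codes with the modulus in the input: residues, products, inverses, Lagrange bases

Literature / complexity toolkit, third MACHINE-LAYER brick of the probabilistically checkable
proofs for exponential-time computations (after `FieldElementsFromCoins.lean`,
`AlgebraicPCPLayout.lean`). The verifier of Babai–Fortnow–Lund / Babai–Fortnow–Levin–Szegedy and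
the writer of its honest proof compute in the prime field `ZMod p` where `p = p(n)` GROWS with the
input length, so the machines must be UNIFORM in the modulus: residues travel as binary numerals of
their values (`ZMod.val`, the code `zmodE` of `GaussRankFP.lean` for a FIXED `p`) and the modulus is
a field of the input, as in the `IP = PSPACE` referee (`ShenRefereeRounds.hornerModC`: modulus
`max q 2`, so that every accumulator bound holds on every input). This file provides, in the typed
polynomial-time algebra `CodeFP` (`CodeFP.lean` ff.):

* **residue arithmetic** `mulMod`, `addMod`, `negMod`, `subMod`, `prodMod` (a reducing fold —
  never the exact product), `sumMod`, `powMod` (unary exponent), `invModB` (Fermat inverse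
  `a^{q-2}` with the exponent capped by a unary budget `B`: a binary modulus has no polynomial
  unary copy), `horner` (evaluation of a coefficient list), each with its `CodeFP` fact
  (`mulModC`, …, `hornerC`; modulus entering as `mhat q = max q 2`);
* **Lagrange bases of the node set `{0, …, h-1}`** (`DigitPoly.nodes h`): `lagNum`, `lagDen`,
  `lagValB` (`L_e(a)`), `eqPolyValB` (`∑ₑ L_e(a) L_e(b)`, the kernel `AlgebraicPCP.eqPoly`), with
  `lagValBC`, `eqPolyValBC` (node count `h` in unary);
* **bridges to `ZMod p`** for a prime `p` (`§ Bridge`): `mulMod_val`, `addMod_val`, `negMod_val`,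
  `subMod_val`, `prodMod_map_val`, `sumMod_map_val`, `powMod_val`, `invModB_val` (`a ≠ 0`,
  `p - 2 ≤ B`), `natCast_lagValB` (`= (Lagrange.basis (nodes h) id e).eval a` for `e < h ≤ p`),
  `natCast_eqPolyValB` (`= eqPoly (nodes h) a b`), `natCast_horner` (`= (ofCoeffs cs).eval x`).

Everything is proved; definitions are the semantic residue functions (no machine is written beyond
the typed combinators, no named fact).

## References

* S. Arora, B. Barak, *Computational Complexity: A Modern Approach*, CUP 2009, §1.3 (polynomial
  time: composition and bounded loops), §A.3 (arithmetic modulo `p`, Fermat inverses), §8.3.2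
  (the verifier evaluates polynomials over `𝔽_p`) [AroraBarakCC2009].
* J. von zur Gathen, J. Gerhard, *Modern Computer Algebra*, 3rd ed., CUP 2013, §4.1, §5.2
  (modular arithmetic, Lagrange interpolation). (Schoolbook; proved here.)
-/

noncomputable section

open Finset Polynomial

namespace Literature.Computability.Complexity

namespace PFCode

/-! ### Residue arithmetic (semantics) -/

/-- The working modulus `max q 2` of a claimed modulus `q`. [folklore] -/
def mhat (q : ℕ) : ℕ := max q 2

/-- `2 ≤ mhat q`. [folklore] -/
theorem two_le_mhat (q : ℕ) : 2 ≤ mhat q := le_max_right _ _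

/-- `0 < mhat q`. [folklore] -/
theorem mhat_pos (q : ℕ) : 0 < mhat q := lt_of_lt_of_le zero_lt_two (two_le_mhat q)

/-- For `q ≥ 2` the working modulus is `q`. [folklore] -/
theorem mhat_eq {q : ℕ} (hq : 2 ≤ q) : mhat q = q := max_eq_left hq

/-- Product of residues. [cite: AroraBarakCC2009, §A.3] -/
def mulMod (q a b : ℕ) : ℕ := a * b % q
/-- Sum of residues. [cite: AroraBarakCC2009, §A.3] -/
def addMod (q a b : ℕ) : ℕ := (a + b) % q
/-- Negation of a residue. [cite: AroraBarakCC2009, §A.3] -/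
def negMod (q a : ℕ) : ℕ := (q - a % q) % q
/-- Difference of residues. [cite: AroraBarakCC2009, §A.3] -/
def subMod (q a b : ℕ) : ℕ := (a + negMod q b) % q
/-- **Reducing product of a list of residues** (reduced after every factor). [cite: AroraBarakCC2009, §A.3] -/
def prodMod (q : ℕ) (l : List ℕ) : ℕ := l.foldl (fun acc a => acc * a % q) (1 % q)
/-- Reducing sum of a list of residues. [cite: AroraBarakCC2009, §A.3] -/
def sumMod (q : ℕ) (l : List ℕ) : ℕ := l.foldl (fun acc a => (acc + a) % q) 0
/-- Powers (exponent in unary at the machine level). [cite: AroraBarakCC2009, §A.3] -/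
def powMod (q a k : ℕ) : ℕ := prodMod q (List.replicate k a)
/-- **Fermat inverse with a capped exponent**: `a^{min (q-2) B}`. [cite: AroraBarakCC2009, §A.3 (a⁻¹ = a^{p-2})] -/
def invModB (q B a : ℕ) : ℕ := powMod q a (min (q - 2) B)
/-- **Horner evaluation** of the coefficient list `c₀, c₁, …` at `x`: `∑ᵢ cᵢ xⁱ mod q`. [cite: AroraBarakCC2009, §8.3.2] -/
def horner (q x : ℕ) (cs : List ℕ) : ℕ := cs.foldr (fun c acc => (c + x * acc) % q) 0

/-- A reduced value is below the modulus. [folklore] -/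
theorem mod_lt_mhat (q x : ℕ) : x % mhat q < mhat q := Nat.mod_lt _ (mhat_pos q)

/-- `prodMod` from an arbitrary accumulator stays below the modulus. [folklore] -/
theorem foldl_mulMod_lt (q : ℕ) : ∀ (l : List ℕ) (acc : ℕ), acc < mhat q →
    l.foldl (fun acc a => acc * a % mhat q) acc < mhat q
  | [], _, h => h
  | _ :: l, _, _ => foldl_mulMod_lt q l _ (mod_lt_mhat q _)

/-- `sumMod` from an arbitrary accumulator stays below the modulus. [folklore] -/
theorem foldl_addMod_lt (q : ℕ) : ∀ (l : List ℕ) (acc : ℕ), acc < mhat q →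
    l.foldl (fun acc a => (acc + a) % mhat q) acc < mhat q
  | [], _, h => h
  | _ :: l, _, _ => foldl_addMod_lt q l _ (mod_lt_mhat q _)

/-- Horner values are below the modulus (or `0`). [folklore] -/
theorem horner_lt (q x : ℕ) : ∀ cs : List ℕ, horner (mhat q) x cs < mhat q
  | [] => mhat_pos q
  | _ :: cs => by unfold horner; rw [List.foldr_cons]; exact mod_lt_mhat q _

/-! ### Lagrange bases of `{0, …, h-1}` (semantics) -/

/-- Numerator `∏_{e' < h, e' ≠ e} (a - e')` of the basis polynomial of node `e` at `a`. [cite: AroraBarakCC2009, §A.6 (Lagrange)] -/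
def lagNum (q h e a : ℕ) : ℕ := prodMod q (((List.range h).filter (· ≠ e)).map fun e' => subMod q a e')

/-- Denominator `∏_{e' < h, e' ≠ e} (e - e')`. [cite: AroraBarakCC2009, §A.6] -/
def lagDen (q h e : ℕ) : ℕ := prodMod q (((List.range h).filter (· ≠ e)).map fun e' => subMod q e e')

/-- **The basis value `L_e(a)`** (inverse by Fermat with budget `B`). [cite: AroraBarakCC2009, §A.6] -/
def lagValB (q B h e a : ℕ) : ℕ := mulMod q (lagNum q h e a) (invModB q B (lagDen q h e))

/-- **The kernel `∑_{e < h} L_e(a) L_e(b)`** (`AlgebraicPCP.eqPoly` of the node set). [cite: BFLS1991, §4] -/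
def eqPolyValB (q B h a b : ℕ) : ℕ := sumMod q ((List.range h).map fun e => mulMod q (lagValB q B h e a) (lagValB q B h e b))

/-! ### Bridge to `ZMod p` -/

section Bridge

variable {p : ℕ} [hp : Fact p.Prime]

/-- A prime is its own working modulus. [folklore] -/
theorem mhat_prime : mhat p = p := mhat_eq hp.out.two_le

/-- `mulMod` computes products. [folklore] -/
theorem mulMod_val (a b : ZMod p) : mulMod p a.val b.val = (a * b).val := by
  rw [mulMod, ZMod.val_mul]

/-- `addMod` computes sums. [folklore] -/
theorem addMod_val (a b : ZMod p) : addMod p a.val b.val = (a + b).val := by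
  rw [addMod, ZMod.val_add]

/-- `negMod` computes negations. [folklore] -/
theorem negMod_val (a : ZMod p) : negMod p a.val = (-a).val := by
  rw [negMod, ZMod.neg_val', Nat.mod_eq_of_lt (ZMod.val_lt a)]

/-- `subMod` computes differences. [folklore] -/
theorem subMod_val (a b : ZMod p) : subMod p a.val b.val = (a - b).val := by
  rw [subMod, negMod_val, ← ZMod.val_add, sub_eq_add_neg]

/-- The reducing product fold computes products. [folklore] -/
theorem foldl_mulMod_val (l : List (ZMod p)) : ∀ c : ZMod p,
    (l.map ZMod.val).foldl (fun acc a => acc * a % p) c.val = (c * l.prod).val := by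
  induction l with
  | nil => intro c; simp
  | cons a l ih =>
    intro c
    rw [List.map_cons, List.foldl_cons, ← ZMod.val_mul, ih, List.prod_cons, mul_assoc]

/-- `prodMod` computes products of lists. [folklore] -/
theorem prodMod_map_val (l : List (ZMod p)) : prodMod p (l.map ZMod.val) = l.prod.val := by
  unfold prodMod
  rw [show 1 % p = (1 : ZMod p).val by rw [ZMod.val_one'', Nat.mod_eq_of_lt hp.out.one_lt]; exact hp.out.one_lt.ne',
    foldl_mulMod_val, one_mul]

/-- The reducing sum fold computes sums. [folklore] -/
theorem foldl_addMod_val (l : List (ZMod p)) : ∀ c : ZMod p,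
    (l.map ZMod.val).foldl (fun acc a => (acc + a) % p) c.val = (c + l.sum).val := by
  induction l with
  | nil => intro c; simp
  | cons a l ih =>
    intro c
    rw [List.map_cons, List.foldl_cons, ← ZMod.val_add, ih, List.sum_cons, add_assoc]

/-- `sumMod` computes sums of lists. [folklore] -/
theorem sumMod_map_val (l : List (ZMod p)) : sumMod p (l.map ZMod.val) = l.sum.val := by
  unfold sumMod
  rw [show (0 : ℕ) = (0 : ZMod p).val by rw [ZMod.val_zero], foldl_addMod_val, zero_add]

/-- `powMod` computes powers. [folklore] -/
theorem powMod_val (a : ZMod p) (k : ℕ) : powMod p a.val k = (a ^ k).val := by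
  unfold powMod
  rw [← List.map_replicate, prodMod_map_val, List.prod_replicate]

/-- **Fermat**: `invModB` computes inverses of nonzero residues once the budget covers `p - 2`.
[cite: AroraBarakCC2009, §A.3] -/
theorem invModB_val {B : ℕ} (hB : p - 2 ≤ B) {a : ZMod p} (ha : a ≠ 0) : invModB p B a.val = (a⁻¹).val := by
  unfold invModB
  rw [min_eq_left hB, powMod_val]
  congr 1
  have h1 : a ^ (p - 2) * a = 1 := by
    rw [← pow_succ, show p - 2 + 1 = p - 1 from by have := hp.out.two_le; omega]
    exact ZMod.pow_card_sub_one_eq_one ha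
  calc a ^ (p - 2) = a ^ (p - 2) * a * a⁻¹ := by rw [mul_assoc, mul_inv_cancel₀ ha, mul_one]
    _ = a⁻¹ := by rw [h1, one_mul]

/-- Values of residues are recovered by the cast. [folklore] -/
theorem natCast_eq_iff_eq_val {x : ℕ} (hx : x < p) (a : ZMod p) : (x : ZMod p) = a ↔ x = a.val := by
  constructor
  · rintro rfl; rw [ZMod.val_natCast, Nat.mod_eq_of_lt hx]
  · rintro rfl; exact ZMod.natCast_zmod_val a

/-- The polynomial with a given coefficient list: `ofCoeffs [c₀, c₁, …] = ∑ᵢ cᵢ Xⁱ`. [folklore] -/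
def ofCoeffs {R : Type*} [Semiring R] : List R → R[X]
  | [] => 0
  | c :: cs => C c + X * ofCoeffs cs

/-- **Horner computes evaluation**: `horner p x cs = (ofCoeffs cs).eval x` on values. [cite: AroraBarakCC2009, §8.3.2] -/
theorem natCast_horner (x : ZMod p) (cs : List (ZMod p)) :
    (horner p x.val (cs.map ZMod.val) : ZMod p) = (ofCoeffs cs).eval x := by
  induction cs with
  | nil => simp [horner, ofCoeffs]
  | cons c cs ih =>
    unfold horner at ih ⊢
    rw [List.map_cons, List.foldr_cons, ZMod.natCast_mod, Nat.cast_add, Nat.cast_mul, ih, ZMod.natCast_zmod_val,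
      ZMod.natCast_zmod_val, ofCoeffs, eval_add, eval_C, eval_mul, eval_X]

/-- Coefficients of `ofCoeffs`. [folklore] -/
theorem coeff_ofCoeffs {R : Type*} [Semiring R] : ∀ (cs : List R) (i : ℕ), (ofCoeffs cs).coeff i = cs.getD i 0
  | [], i => by simp [ofCoeffs]
  | c :: cs, 0 => by simp [ofCoeffs, coeff_C]
  | c :: cs, i + 1 => by
    rw [ofCoeffs, coeff_add, coeff_C, if_neg (Nat.succ_ne_zero i), zero_add, coeff_X_mul, coeff_ofCoeffs cs i,
      List.getD_cons_succ]

/-- `ofCoeffs` as a sum of monomials. [folklore] -/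
theorem ofCoeffs_eq_sum {R : Type*} [Semiring R] : ∀ cs : List R,
    ofCoeffs cs = ∑ i ∈ range cs.length, C (cs.getD i 0) * X ^ i
  | [] => by simp [ofCoeffs]
  | c :: cs => by
    rw [ofCoeffs, ofCoeffs_eq_sum cs, List.length_cons, sum_range_succ', mul_sum]
    simp only [List.getD_cons_succ, List.getD_cons_zero, pow_zero, mul_one, pow_succ]
    rw [add_comm]
    congr 1
    refine sum_congr rfl fun i _ => ?_
    rw [X_mul, mul_assoc]

/-- `ofCoeffs` of the list of values of `c` on `range n` is `∑_{i<n} c i Xⁱ`. [folklore] -/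
theorem ofCoeffs_map_range {R : Type*} [Semiring R] (c : ℕ → R) (n : ℕ) :
    ofCoeffs ((List.range n).map c) = ∑ i ∈ range n, C (c i) * X ^ i := by
  rw [ofCoeffs_eq_sum, List.length_map, List.length_range]
  refine sum_congr rfl fun i hi => ?_
  rw [List.getD_eq_getElem _ _ (by simpa using mem_range.1 hi)]
  simp

/-! ### Bridge: Lagrange bases of the node set -/

/-- Small naturals cast injectively. [folklore] -/
theorem cast_injOn_range {h : ℕ} (hh : h ≤ p) : Set.InjOn (Nat.cast : ℕ → ZMod p) (range h : Finset ℕ) := by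
  intro a ha b hb hab
  have ha' : a < p := lt_of_lt_of_le (mem_range.1 ha) hh
  have hb' : b < p := lt_of_lt_of_le (mem_range.1 hb) hh
  have := (ZMod.natCast_eq_natCast_iff' a b p).1 hab
  rwa [Nat.mod_eq_of_lt ha', Nat.mod_eq_of_lt hb'] at this

/-- The node set without node `e` is the image of `{e' < h | e' ≠ e}`. [folklore] -/
theorem nodes_erase_eq_image {h e : ℕ} (hh : h ≤ p) (he : e < h) :
    (DigitPoly.nodes (F := ZMod p) h).erase (e : ZMod p) = ((range h).filter (· ≠ e)).image (Nat.cast : ℕ → ZMod p) := by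
  unfold DigitPoly.nodes
  ext x
  simp only [mem_erase, mem_image, mem_filter, mem_range]
  constructor
  · rintro ⟨hne, a, ha, rfl⟩
    exact ⟨a, ⟨ha, fun hae => hne (by rw [hae])⟩, rfl⟩
  · rintro ⟨a, ⟨ha, hne⟩, rfl⟩
    refine ⟨fun heq => hne (cast_injOn_range hh (mem_range.2 ha) (mem_range.2 he) heq), a, ha, rfl⟩

/-- Value of a small natural. [folklore] -/
theorem val_cast_of_lt {a : ℕ} (ha : a < p) : (a : ZMod p).val = a := by
  rw [ZMod.val_natCast, Nat.mod_eq_of_lt ha]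

/-- `prodMod p` of a list of values, cast back. [folklore] -/
theorem natCast_prodMod_map_val (l : List (ZMod p)) : (prodMod p (l.map ZMod.val) : ZMod p) = l.prod := by
  rw [prodMod_map_val, ZMod.natCast_zmod_val]

/-- The map `e' ↦ subMod p a e'` on small naturals is `e' ↦ val (a - e')`. [folklore] -/
theorem map_subMod_eq {h : ℕ} (hh : h ≤ p) (a : ZMod p) (l : List ℕ) (hl : ∀ e' ∈ l, e' < h) :
    l.map (fun e' => subMod p a.val e') = (l.map fun e' : ℕ => a - (e' : ZMod p)).map ZMod.val := by
  rw [List.map_map]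
  refine List.map_congr_left fun e' he' => ?_
  show subMod p a.val e' = (a - (e' : ZMod p)).val
  rw [← subMod_val, val_cast_of_lt (lt_of_lt_of_le (hl e' he') hh)]

/-- The numerator is `∏ (a - e')`. [folklore] -/
theorem natCast_lagNum {h e : ℕ} (hh : h ≤ p) (a : ZMod p) :
    (lagNum p h e a.val : ZMod p) = (((List.range h).filter (· ≠ e)).map fun e' : ℕ => a - (e' : ZMod p)).prod := by
  unfold lagNum
  rw [map_subMod_eq hh a _ (fun e' he' => List.mem_range.1 (List.mem_filter.1 he').1), natCast_prodMod_map_val]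

/-- The denominator is `∏ (e - e')`. [folklore] -/
theorem natCast_lagDen {h e : ℕ} (hh : h ≤ p) (he : e < h) :
    (lagDen p h e : ZMod p) = (((List.range h).filter (· ≠ e)).map fun e' : ℕ => (e : ZMod p) - (e' : ZMod p)).prod := by
  unfold lagDen
  rw [← val_cast_of_lt (lt_of_lt_of_le he hh), map_subMod_eq hh _ _ (fun e' he' => List.mem_range.1 (List.mem_filter.1 he').1),
    natCast_prodMod_map_val, val_cast_of_lt (lt_of_lt_of_le he hh)]

/-- The denominator is nonzero. [folklore] -/
theorem lagDen_cast_ne_zero {h e : ℕ} (hh : h ≤ p) (he : e < h) : (lagDen p h e : ZMod p) ≠ 0 := by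
  rw [natCast_lagDen hh he]
  refine List.prod_ne_zero fun h0 => ?_
  obtain ⟨e', he', h0'⟩ := List.mem_map.1 h0
  have he'' := List.mem_filter.1 he'
  have hlt : e' < h := List.mem_range.1 he''.1
  have hne : e' ≠ e := by simpa using he''.2
  have hce : (e : ZMod p) = (e' : ZMod p) := sub_eq_zero.1 h0'
  exact hne (cast_injOn_range hh (mem_range.2 hlt) (mem_range.2 he) hce.symm)

/-- `prodMod` results are below the working modulus. [folklore] -/
theorem prodMod_lt (q : ℕ) (l : List ℕ) : prodMod (mhat q) l < mhat q :=
  foldl_mulMod_lt q l _ (mod_lt_mhat q 1)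

/-- `lagDen p` is below `p`. [folklore] -/
theorem lagDen_lt (h e : ℕ) : lagDen p h e < p := by
  have := prodMod_lt p (((List.range h).filter (· ≠ e)).map fun e' => subMod (mhat p) e e')
  unfold lagDen
  rwa [mhat_prime] at this

/-- **The basis value**: `lagValB p B h e a = L_e(a)` for `e < h ≤ p` and budget `B ≥ p - 2`, where
`L_e` is the Lagrange basis polynomial of the node set `{0, …, h-1}` at node `e`.
[cite: AroraBarakCC2009, §A.6] -/
theorem natCast_lagValB {B h e : ℕ} (hB : p - 2 ≤ B) (hh : h ≤ p) (he : e < h) (a : ZMod p) :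
    (lagValB p B h e a.val : ZMod p) = (Lagrange.basis (DigitPoly.nodes (F := ZMod p) h) id (e : ZMod p)).eval a := by
  -- the machine side
  set Dn : ZMod p := (lagDen p h e : ZMod p) with hDn
  have hDn0 : Dn ≠ 0 := lagDen_cast_ne_zero hh he
  have hden : lagDen p h e = Dn.val := by rw [hDn, val_cast_of_lt (lagDen_lt h e)]
  have hinv : (invModB p B (lagDen p h e) : ZMod p) = Dn⁻¹ := by
    rw [hden, invModB_val hB hDn0, ZMod.natCast_zmod_val]
  have hlhs : (lagValB p B h e a.val : ZMod p) = (lagNum p h e a.val : ZMod p) * Dn⁻¹ := by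
    unfold lagValB mulMod
    rw [ZMod.natCast_mod, Nat.cast_mul, hinv]
  have hnodup : ((List.range h).filter (· ≠ e)).Nodup := List.nodup_range.filter _
  have htf : ((range h).filter (· ≠ e)) = ((List.range h).filter (· ≠ e)).toFinset := by
    ext x; simp
  rw [hlhs, natCast_lagNum hh, hDn, natCast_lagDen hh he, ← List.prod_toFinset _ hnodup, ← List.prod_toFinset _ hnodup, ← htf]
  -- the Lagrange side
  rw [Lagrange.basis, eval_prod, nodes_erase_eq_image hh he,
    prod_image fun a ha b hb hab => cast_injOn_range hh (mem_of_mem_filter a ha) (mem_of_mem_filter b hb) hab]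
  simp only [id, Lagrange.basisDivisor, eval_mul, eval_C, eval_sub, eval_X]
  rw [prod_mul_distrib, prod_inv_distrib, mul_comm]

/-- `lagValB p` is below `p`. [folklore] -/
theorem lagValB_lt (B h e a : ℕ) : lagValB p B h e a < p := by
  unfold lagValB mulMod; exact Nat.mod_lt _ hp.out.pos

/-- **The kernel**: `eqPolyValB p B h a b = AlgebraicPCP.eqPoly (nodes h) a b` for `h ≤ p`, `B ≥ p - 2`.
[cite: BFLS1991, §4] -/
theorem natCast_eqPolyValB {B h : ℕ} (hB : p - 2 ≤ B) (hh : h ≤ p) (a b : ZMod p) :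
    (eqPolyValB p B h a.val b.val : ZMod p) = AlgebraicPCP.eqPoly (DigitPoly.nodes (F := ZMod p) h) a b := by
  unfold eqPolyValB AlgebraicPCP.eqPoly
  have hl : ((List.range h).map fun e => mulMod p (lagValB p B h e a.val) (lagValB p B h e b.val)) =
      ((List.range h).map fun e : ℕ => (Lagrange.basis (DigitPoly.nodes (F := ZMod p) h) id (e : ZMod p)).eval a *
        (Lagrange.basis (DigitPoly.nodes (F := ZMod p) h) id (e : ZMod p)).eval b).map ZMod.val := by
    rw [List.map_map]
    refine List.map_congr_left fun e he => ?_
    have he' : e < h := List.mem_range.1 he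
    show mulMod p (lagValB p B h e a.val) (lagValB p B h e b.val) =
      ((Lagrange.basis (DigitPoly.nodes (F := ZMod p) h) id (e : ZMod p)).eval a *
        (Lagrange.basis (DigitPoly.nodes (F := ZMod p) h) id (e : ZMod p)).eval b).val
    rw [← natCast_lagValB hB hh he' a, ← natCast_lagValB hB hh he' b, ZMod.val_mul, ZMod.val_natCast, ZMod.val_natCast,
      Nat.mod_eq_of_lt (lagValB_lt B h e _), Nat.mod_eq_of_lt (lagValB_lt B h e _), mulMod]
  rw [hl, sumMod_map_val, ZMod.natCast_zmod_val, ← List.sum_toFinset _ List.nodup_range, List.toFinset_range,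
    DigitPoly.nodes, sum_image fun a ha b hb hab => cast_injOn_range hh ha hb hab]

end Bridge

/-! ### The machines: residue arithmetic on codes, modulus in the input -/

section Machines

open CodeFP

/-- `|bin (mhat q)| ≤ |bin q| + 2`. [folklore] -/
theorem length_natE_mhat_le (q : ℕ) : (natE (mhat q)).length ≤ (natE q).length + 2 := by
  rw [length_natE, length_natE, mhat]
  rcases le_or_gt q 2 with h | h
  · rw [max_eq_right h]; exact (Nat.size_le.2 (by norm_num)).trans (Nat.le_add_left _ _)
  · rw [max_eq_left h.le]; omega

/-- A number below the working modulus has a short numeral. [folklore] -/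
theorem length_natE_le_of_lt_mhat {q x : ℕ} (hx : x < mhat q) : (natE x).length ≤ (natE q).length + 2 :=
  le_trans (by rw [length_natE, length_natE]; exact size_mono hx.le) (length_natE_mhat_le q)

/-- **The working modulus on codes.** [folklore] -/
theorem mhatC : CodeFP natE natE mhat := (natMax.comp ((CodeFP.id natE).pair (const natE 2)) :)

/-- **Modular product on codes**: `(q, a, b) ↦ a b mod mhat q`. [cite: AroraBarakCC2009, §A.3] -/
theorem mulModC : CodeFP (pairE natE (pairE natE natE)) natE (fun t => mulMod (mhat t.1) t.2.1 t.2.2) :=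
  (natMod.comp ((natMul.comp (snd _ _)).pair (mhatC.comp (fst _ _))) :)

/-- **Modular sum on codes.** [cite: AroraBarakCC2009, §A.3] -/
theorem addModC : CodeFP (pairE natE (pairE natE natE)) natE (fun t => addMod (mhat t.1) t.2.1 t.2.2) :=
  (natMod.comp ((natAdd.comp (snd _ _)).pair (mhatC.comp (fst _ _))) :)

/-- **Modular negation on codes.** [cite: AroraBarakCC2009, §A.3] -/
theorem negModC : CodeFP (pairE natE natE) natE (fun t => negMod (mhat t.1) t.2) := by
  have hm : CodeFP (pairE natE natE) natE (fun t => mhat t.1) := mhatC.comp (fst _ _)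
  have h1 : CodeFP (pairE natE natE) natE (fun t => t.2 % mhat t.1) := (natMod.comp ((snd _ _).pair hm) :)
  have h2 : CodeFP (pairE natE natE) natE (fun t => mhat t.1 - t.2 % mhat t.1) := (natSub.comp (hm.pair h1) :)
  exact (natMod.comp (h2.pair hm) :)

/-- **Modular difference on codes.** [cite: AroraBarakCC2009, §A.3] -/
theorem subModC : CodeFP (pairE natE (pairE natE natE)) natE (fun t => subMod (mhat t.1) t.2.1 t.2.2) := by
  have hneg : CodeFP (pairE natE (pairE natE natE)) natE (fun t => negMod (mhat t.1) t.2.2) :=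
    (negModC.comp ((fst _ _).pair (snd _ _).snd') :)
  have hsum : CodeFP (pairE natE (pairE natE natE)) natE (fun t => t.2.1 + negMod (mhat t.1) t.2.2) :=
    (natAdd.comp ((snd _ _).fst'.pair hneg) :)
  exact (natMod.comp (hsum.pair (mhatC.comp (fst _ _))) :)

/-- The pair code dominates its first field. [folklore] -/
theorem length_fst_le_pairE (a : ℕ) {β : Type} (eβ : β → List Bool) (b : β) :
    (natE a).length + 2 ≤ (pairE natE eβ (a, b)).length := by
  show (natE a).length + 2 ≤ (boolPair (natE a) (eβ b)).length
  rw [length_boolPair]; omega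

/-- **Reducing products on codes**: `(q, l) ↦ prodMod (mhat q) l`. [cite: AroraBarakCC2009, §A.3, §1.3] -/
theorem prodModC : CodeFP (pairE natE (rawE natE)) natE (fun t => prodMod (mhat t.1) t.2) := by
  have hstep : CodeFP (pairE natE (pairE natE natE)) natE (fun t => t.2.2 * t.2.1 % mhat t.1) :=
    (natMod.comp ((natMul.comp ((snd _ _).snd'.pair (snd _ _).fst')).pair (mhatC.comp (fst _ _))) :)
  have hinit : CodeFP natE natE (fun s => 1 % mhat s) := (natMod.comp ((const natE 1).pair mhatC) :)
  have h := foldl (σ := ℕ) (α := ℕ) (β := ℕ) (eσ := natE) (eα := natE) (eβ := natE)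
    (step := fun s a acc => acc * a % mhat s) (init := fun s => 1 % mhat s) hstep hinit (X + C 2)
    (fun s l₁ l₂ => by
      rw [eval_add, eval_X, eval_C]
      exact (length_natE_le_of_lt_mhat (foldl_mulMod_lt s l₁ _ (mod_lt_mhat s 1))).trans
        ((length_fst_le_pairE s _ _).trans (Nat.le_add_right _ _)))
  exact (h :)

/-- **Reducing sums on codes.** [cite: AroraBarakCC2009, §A.3, §1.3] -/
theorem sumModC : CodeFP (pairE natE (rawE natE)) natE (fun t => sumMod (mhat t.1) t.2) := by
  have hstep : CodeFP (pairE natE (pairE natE natE)) natE (fun t => (t.2.2 + t.2.1) % mhat t.1) :=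
    (natMod.comp ((natAdd.comp ((snd _ _).snd'.pair (snd _ _).fst')).pair (mhatC.comp (fst _ _))) :)
  have h := foldl (σ := ℕ) (α := ℕ) (β := ℕ) (eσ := natE) (eα := natE) (eβ := natE)
    (step := fun s a acc => (acc + a) % mhat s) (init := fun _ => 0) hstep (const natE 0) (X + C 2)
    (fun s l₁ l₂ => by
      rw [eval_add, eval_X, eval_C]
      exact (length_natE_le_of_lt_mhat (foldl_addMod_lt s l₁ _ (mhat_pos s))).trans
        ((length_fst_le_pairE s _ _).trans (Nat.le_add_right _ _)))
  exact (h :)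

/-- **Modular powers on codes** (unary exponent): `(q, a, 1ᵏ) ↦ aᵏ mod mhat q`. [cite: AroraBarakCC2009, §A.3] -/
theorem powModC : CodeFP (pairE natE (pairE natE unE)) natE (fun t => powMod (mhat t.1) t.2.1 t.2.2) :=
  (prodModC.comp ((fst _ _).pair ((replicateOf natE).comp (snd _ _))) :)

/-- **Fermat inverses on codes** (budget `1ᴮ` for the exponent): `((q, 1ᴮ), a) ↦ a^{min (mhat q - 2) B}`.
[cite: AroraBarakCC2009, §A.3] -/
theorem invModBC : CodeFP (pairE (pairE natE unE) natE) natE (fun t => invModB (mhat t.1.1) t.1.2 t.2) := by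
  have hq : CodeFP (pairE (pairE natE unE) natE) natE (fun t => mhat t.1.1) := mhatC.comp (fst _ _).fst'
  have he : CodeFP (pairE (pairE natE unE) natE) unE (fun t => min (mhat t.1.1 - 2) t.1.2) :=
    (unOfNatMin.comp ((fst _ _).snd'.pair (natSub.comp (hq.pair (const _ 2)))) :)
  exact (powModC.comp ((fst _ _).fst'.pair ((snd _ _).pair he)) :)

/-- The Horner fold stays below the modulus. [folklore] -/
theorem foldl_horner_lt (q x : ℕ) : ∀ (l : List ℕ) (acc : ℕ), acc < mhat q →
    l.foldl (fun acc c => (c + x * acc) % mhat q) acc < mhat q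
  | [], _, h => h
  | _ :: l, _, _ => foldl_horner_lt q x l _ (mod_lt_mhat q _)

/-- **Horner evaluation on codes**: `(q, x, cs) ↦ horner (mhat q) x cs`. [cite: AroraBarakCC2009, §8.3.2] -/
theorem hornerC : CodeFP (pairE natE (pairE natE (rawE natE))) natE (fun t => horner (mhat t.1) t.2.1 t.2.2) := by
  have hstep : CodeFP (pairE (pairE natE natE) (pairE natE natE)) natE
      (fun t : (ℕ × ℕ) × ℕ × ℕ => (t.2.1 + t.1.2 * t.2.2) % mhat t.1.1) := by
    have hq : CodeFP (pairE (pairE natE natE) (pairE natE natE)) natE (fun t : (ℕ × ℕ) × ℕ × ℕ => mhat t.1.1) :=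
      mhatC.comp (fst _ _).fst'
    have h1 : CodeFP (pairE (pairE natE natE) (pairE natE natE)) natE (fun t : (ℕ × ℕ) × ℕ × ℕ => t.1.2 * t.2.2) :=
      (natMul.comp ((fst _ _).snd'.pair (snd _ _).snd') :)
    have h2 : CodeFP (pairE (pairE natE natE) (pairE natE natE)) natE (fun t : (ℕ × ℕ) × ℕ × ℕ => t.2.1 + t.1.2 * t.2.2) :=
      (natAdd.comp ((snd _ _).fst'.pair h1) :)
    exact (natMod.comp (h2.pair hq) :)
  have hfold : CodeFP (pairE (pairE natE natE) (rawE natE)) natE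
      (fun t => t.2.foldl (fun acc c => (c + t.1.2 * acc) % mhat t.1.1) 0) := by
    refine foldl (σ := ℕ × ℕ) (α := ℕ) (β := ℕ) (eσ := pairE natE natE) (eα := natE) (eβ := natE)
      (step := fun s c acc => (c + s.2 * acc) % mhat s.1) (init := fun _ => 0) hstep (const _ 0) (X + C 2)
      (fun s l₁ l₂ => ?_)
    rw [eval_add, eval_X, eval_C]
    refine (length_natE_le_of_lt_mhat (foldl_horner_lt s.1 s.2 l₁ 0 (mhat_pos _))).trans ?_
    obtain ⟨q, x⟩ := s
    show (natE q).length + 2 ≤ (boolPair (boolPair (natE q) (natE x)) (rawE natE (l₁ ++ l₂))).length + 2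
    rw [length_boolPair, length_boolPair]
    omega
  refine ((hfold.comp (((fst _ _).pair (snd _ _).fst').pair ((rawReverse natE).comp (snd _ _).snd'))).congr fun t => ?_)
  show t.2.2.reverse.foldl _ 0 = horner (mhat t.1) t.2.1 t.2.2
  rw [horner, List.foldl_reverse]

/-! ### The machines: Lagrange bases -/

/-- The argument record of the basis machines: `(q, (1ʰ, (e, a)))`. [folklore] -/
abbrev LagT : Type := ℕ × ℕ × ℕ × ℕ

/-- Its code. [folklore] -/
abbrev lagE : LagT → List Bool := pairE natE (pairE unE (pairE natE natE))

/-- The filtered node list `[e' < h | e' ≠ e]` on codes. [folklore] -/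
theorem lagListC : CodeFP lagE (rawE natE) (fun t : LagT => (List.range t.2.1).filter (· ≠ t.2.2.1)) := by
  have hp : CodeFP (pairE lagE natE) bitE (fun q : LagT × ℕ => !decide (q.2 = q.1.2.2.1)) :=
    (natEq.comp ((snd _ _).pair (fst _ _).snd'.snd'.fst')).not
  have hf := filter (σ := LagT) (α := ℕ) (eσ := lagE) (eα := natE) hp
  refine ((hf.comp ((CodeFP.id lagE).pair (urange.comp (snd _ _).fst'))).congr fun t => ?_)
  exact List.filter_congr fun x _ => by simp

/-- **The numerator on codes**: `(q, 1ʰ, e, a) ↦ lagNum (mhat q) h e a`. [cite: AroraBarakCC2009, §A.6, §1.3] -/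
theorem lagNumC : CodeFP lagE natE (fun t : LagT => lagNum (mhat t.1) t.2.1 t.2.2.1 t.2.2.2) := by
  have hg : CodeFP (pairE lagE natE) natE (fun q : LagT × ℕ => subMod (mhat q.1.1) q.1.2.2.2 q.2) :=
    (subModC.comp ((fst _ _).fst'.pair ((fst _ _).snd'.snd'.snd'.pair (snd _ _))) :)
  have hm := map (σ := LagT) (α := ℕ) (eσ := lagE) (eα := natE) (eβ := natE) hg
  have hl : CodeFP lagE (rawE natE) (fun t : LagT => ((List.range t.2.1).filter (· ≠ t.2.2.1)).map fun e' => subMod (mhat t.1) t.2.2.2 e') :=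
    (hm.comp ((CodeFP.id lagE).pair lagListC) :)
  exact (prodModC.comp ((fst _ _).pair hl) :)

/-- **The denominator on codes**: `(q, 1ʰ, e, a) ↦ lagDen (mhat q) h e` (ignores `a`). [cite: AroraBarakCC2009, §A.6, §1.3] -/
theorem lagDenC : CodeFP lagE natE (fun t : LagT => lagDen (mhat t.1) t.2.1 t.2.2.1) := by
  have hg : CodeFP (pairE lagE natE) natE (fun q : LagT × ℕ => subMod (mhat q.1.1) q.1.2.2.1 q.2) :=
    (subModC.comp ((fst _ _).fst'.pair ((fst _ _).snd'.snd'.fst'.pair (snd _ _))) :)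
  have hm := map (σ := LagT) (α := ℕ) (eσ := lagE) (eα := natE) (eβ := natE) hg
  have hl : CodeFP lagE (rawE natE) (fun t : LagT => ((List.range t.2.1).filter (· ≠ t.2.2.1)).map fun e' => subMod (mhat t.1) t.2.2.1 e') :=
    (hm.comp ((CodeFP.id lagE).pair lagListC) :)
  exact (prodModC.comp ((fst _ _).pair hl) :)

/-- The argument record with a budget: `((q, 1ᴮ), (1ʰ, (e, a)))`. [folklore] -/
abbrev LagBT : Type := (ℕ × ℕ) × ℕ × ℕ × ℕ

/-- Its code. [folklore] -/
abbrev lagBE : LagBT → List Bool := pairE (pairE natE unE) (pairE unE (pairE natE natE))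

/-- Dropping the budget. [folklore] -/
theorem lagB_to_lag : CodeFP lagBE lagE (fun t : LagBT => (t.1.1, t.2)) := (fst _ _).fst'.pair (snd _ _)

/-- **The basis value on codes**: `((q, 1ᴮ), (1ʰ, (e, a))) ↦ lagValB (mhat q) B h e a`.
[cite: AroraBarakCC2009, §A.6, §1.3] -/
theorem lagValBC : CodeFP lagBE natE (fun t : LagBT => lagValB (mhat t.1.1) t.1.2 t.2.1 t.2.2.1 t.2.2.2) := by
  have hnum : CodeFP lagBE natE (fun t : LagBT => lagNum (mhat t.1.1) t.2.1 t.2.2.1 t.2.2.2) := (lagNumC.comp lagB_to_lag :)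
  have hden : CodeFP lagBE natE (fun t : LagBT => lagDen (mhat t.1.1) t.2.1 t.2.2.1) := (lagDenC.comp lagB_to_lag :)
  have hinv : CodeFP lagBE natE (fun t : LagBT => invModB (mhat t.1.1) t.1.2 (lagDen (mhat t.1.1) t.2.1 t.2.2.1)) :=
    (invModBC.comp ((fst _ _).pair hden) :)
  exact (mulModC.comp ((fst _ _).fst'.pair (hnum.pair hinv)) :)

/-- **The kernel on codes**: `((q, 1ᴮ), (1ʰ, (a, b))) ↦ eqPolyValB (mhat q) B h a b`.
[cite: BFLS1991, §4] [cite: AroraBarakCC2009, §1.3] -/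
theorem eqPolyValBC : CodeFP lagBE natE (fun t : LagBT => eqPolyValB (mhat t.1.1) t.1.2 t.2.1 t.2.2.1 t.2.2.2) := by
  -- item map: context `t`, item `e ↦ mulMod (L_e a) (L_e b)`
  have ha : CodeFP (pairE lagBE natE) natE (fun q : LagBT × ℕ => lagValB (mhat q.1.1.1) q.1.1.2 q.1.2.1 q.2 q.1.2.2.1) :=
    (lagValBC.comp ((fst _ _).fst'.pair ((fst _ _).snd'.fst'.pair ((snd _ _).pair (fst _ _).snd'.snd'.fst'))) :)
  have hb : CodeFP (pairE lagBE natE) natE (fun q : LagBT × ℕ => lagValB (mhat q.1.1.1) q.1.1.2 q.1.2.1 q.2 q.1.2.2.2) :=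
    (lagValBC.comp ((fst _ _).fst'.pair ((fst _ _).snd'.fst'.pair ((snd _ _).pair (fst _ _).snd'.snd'.snd'))) :)
  have hg : CodeFP (pairE lagBE natE) natE (fun q : LagBT × ℕ =>
      mulMod (mhat q.1.1.1) (lagValB (mhat q.1.1.1) q.1.1.2 q.1.2.1 q.2 q.1.2.2.1) (lagValB (mhat q.1.1.1) q.1.1.2 q.1.2.1 q.2 q.1.2.2.2)) :=
    (mulModC.comp ((fst _ _).fst'.fst'.pair (ha.pair hb)) :)
  have hm := map (σ := LagBT) (α := ℕ) (eσ := lagBE) (eα := natE) (eβ := natE) hg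
  have hl := (hm.comp ((CodeFP.id lagBE).pair (urange.comp (snd _ _).fst')) :)
  exact (sumModC.comp ((fst _ _).fst'.pair hl) :)

end Machines

end PFCode

end Literature.Computability.Complexity

end
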